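/-
Copyright (c) 2026 the pub-hodgecm-mathlib formalisation cell (harness21).  Prover seat hodgecm-mathlib-K2E1-p13 (g4), Track B ∕ K2-LIT, h413 = `stmt-HodgeConjecture-24833`,
R90-TF S8, deal S8-R46 (2) of R90-CS-plan (g2): the SPLIT sequel of ★ B1-local `K2E1ChiIntertwiningLocalScalarU3` (R90-C10-p07 (ii)) — the χ-twisted `U(2,1)` intertwining local scalar
at a split good place is the TWO-EXPONENT `GL₃` Gindikin–Karpelevich cell (census `R90/S8/CENSUS-SplitU3.K2E1-p13-g4.md`).
-/
import Summits.HodgeConjecture.HodgeConjecture.Theorems.K2E1GindikinKarpelevichSplitGL3Cpow  -- ★ p862622 (R90-C10-p07, file (i) of S8-R56): the TWO-COMPLEX-EXPONENT `GL₃` cell on `F × (F × F)`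
import Summits.HodgeConjecture.HodgeConjecture.Theorems.K2E1IntertwiningLocalMeanSplitU3      -- ★ (K2-defs1 g5): base coordinates `Φ`, ★ `integral_comp_bigCellChange_eq` (generic codomain)
import HarnessLib

/-!
# S8 — `K2E1ChiIntertwiningLocalScalarSplitU3`: THE χ-TWISTED `U(2,1)` INTERTWINING LOCAL SCALAR AT A SPLIT GOOD PLACE = THE TWO-EXPONENT `GL₃` GINDIKIN–KARPELEVICH CELL
# `∫_{F³} max(1,|x|,|z|)^{−w₁}·max(1,|y|,|z−xy|)^{−w₂} = G(w₁)·G(w₂)·G(w₁+w₂−1)`, `G(w) = μ(𝒪)(1−q^{−w})∕(1−q^{1−w})` (every complex `w₁, w₂`; closed form for `Re w_i > 1`)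

Track B ∕ K2-LIT, crux h413 = `stmt-HodgeConjecture-24833`, route of record `HCCMUnconditional`; cell `hodgecm-mathlib`, R90-TF programme, section S8 «ContSpec-n½» (#3∕#2♯ chain:
F4 `K2E1ChiIntertwiningScalarEulerQuotientU3` (R90-CS-p03) consumes the split token at split good places; B1-local ★ `K2E1ChiIntertwiningLocalScalarU3` (R90-C10-p07) is the inert half).
THEOREMS ONLY (no `def`, no `instance`, no `notation`, no named-fact hypothesis, no `sorry`; default heartbeats); lane `--supports stmt-HodgeConjecture-24833 --as helper`
(count-neutral).  A local token pays no socket.  Generic non-archimedean local field `F` (= `L⁺_v` at a place `v` split in `L`), ANY additive Haar `μ`.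

THE MATHEMATICS ([Langlands1971] §3; [Casselman1980] Thm. 3.1 `c_{w₀}(χ) = ∏_{α>0} c_α(χ)`; [MoeglinWaldspurger1995] II.1.7, IV.1.11; [Rogawski1990] §4.5).  At a split place
`U(J₃)(L⁺_v) ≅ GL₃(F)`; on the big cell `w₀·n(x,y,z)` the Iwasawa torus part `diag(t₁,t₂,t₃)` has `|t₃| = A⁻¹`, `|t₂t₃| = B⁻¹`, `|t₁t₂t₃| = 1`, `A = max(1,|x|,|z|)`, `B = max(1,|y|,|z−xy|)`
(★ `K2E1GindikinKarpelevichSplitGL3`; `Q_v = A·B`).  An UNRAMIFIED torus character is a function of `(a, b)`, `A = q^a`, `B = q^b`: `ω = u₁^a·u₂^b` for two INDEPENDENT unit complex numbers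
(root characters `e₂−e₃`, `e₁−e₂`; the long root carries `u₁u₂` — for the S8 Borel datum `φ_w(ϖ)·φ_{w̄}(ϖ) = e·e′`, S8-R46 CHECK).  With `u_i = q^{−it_i}`: `ω·Q^{−z} = A^{−(z+it₁)}·B^{−(z+it₂)}`, and the
Gindikin–Karpelevich product for a GENERAL unramified character is **`∫_{F³} A^{−w₁}B^{−w₂} = G(w₁)·G(w₂)·G(w₁+w₂−1)`** (`e₂−e₃ ↦ w₁`, `e₁−e₂ ↦ w₂`, `e₁−e₃ ↦ w₁+w₂−1`): ★ p862622
`K2E1GindikinKarpelevichSplitGL3Cpow` (R90-C10-p07; the ★ one-exponent real proof ported to two complex exponents).  §1 transports it to `Fin 3 → F` and to the BASE COORDINATES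
`Φ(a,b,t) = (a+δ₁b, −(a−δ₁b), δ₁t − ½(a+δ₁b)(a−δ₁b))` of ★ `K2E1IntertwiningLocalMeanSplitU3` (`‖δ₁‖ = ‖2‖ = 1`).  §2: unit twists are imaginary shifts.  §3 HEAD: under the split SHELL LETTER «`A(Φp) = q^a`,
`B(Φp) = q^b`, `ω(p) = u₁^a u₂^b`» the χ-weighted split local integral is **`μ(𝒪)³·(1 − u₁q^{−z})(1 − u₂q^{−z})(1 − u₁u₂q^{−(2z−1)}) ∕ ((1 − u₁q^{−(z−1)})(1 − u₂q^{−(z−1)})(1 − u₁u₂q^{−(2z−2)}))`**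
(`1 < Re z`) — at `u₁ = u₂ = 1` the ★ split token (`ε_v = +1`) letter for letter; F4's E-shape² × F-shape at split `v` with `(u₁, u₂, u₁u₂) ↦ (e, e′, e·e′)` (normalisation `s = z − 1`).
HONEST SCOPE.  NOT here: the discharge of the split SHELL LETTER for the actual Iwasawa χ-weight of `ι(w₀)·u(X,Z)` (which character sits on which height — the (W)-side split local
algebra); the bridge `Q_v = A(Φ·)·B(Φ·)` to the adelic currency (`v.adicCompletion L⁺`, `integralBox`, `pi ν`) is ★ (`localHeight_rpow_eq_gl3_of_split`, `pi_integralBox_toReal`) = the consumer's `rw`.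
* §1 (transport of ★ p862622 `integral_prod_bigCell_gl3_cpow_eq` — the cell itself is R90-C10-p07's file (i), S8-R56) **`integral_gkCell_pi_cpow_eq`** (`Fin 3 → F`),
  **`integral_splitCell_pi_cpow_eq`** (base coordinates `Φ`);  §2 `exists_cpow_neg_mul_I_eq_of_norm_eq_one` (full-angle convention `u = q^{−it}`), `pow_mul_ofReal_pow_cpow_neg`,
  `cpow_neg_add_mul_I`;  §3 HEAD **`chiLocalIntegral_eq_token_of_shell_split`** (general units) + **`chiLocalIntegral_eq_token_of_shell_split_cm`** (`u₁u₂ = 1`).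
HONEST LABEL: HC_CM is proved only modulo the 7 printed citations (2 remaining named inputs: hLiu418 = `stmt-HodgeConjecture-24832`, h413 = `stmt-HodgeConjecture-24833`) until rung 0
closes; REL ≠ ★ ≠ BUILT; this file asserts no named fact and closes no socket; count-neutral; unconditional local analysis.

## References
* [Langlands1971] R. P. Langlands, *Euler Products* (1971), §3.
* [Casselman1980] W. Casselman, *The unramified principal series of p-adic groups I*, Compositio Math. 40 (1980), §3 Thm. 3.1.
* [MoeglinWaldspurger1995] C. Mœglin, J.-L. Waldspurger, *Spectral Decomposition and Eisenstein Series* (1995), II.1.7, IV.1.11.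
* [Rogawski1990] J. D. Rogawski, *Automorphic Representations of Unitary Groups in Three Variables* (1990), §4.5 p. 45, §13.9 p. 229.
* [Tate1950] J. Tate, *Fourier analysis in number fields and Hecke's zeta-functions* (1950), §2.2 Lemma 2.2.5.
-/

set_option autoImplicit false
set_option linter.dupNamespace false  -- the mandated namespace repeats `HodgeConjecture.HodgeConjecture`

noncomputable section

open MeasureTheory MeasureTheory.Measure Filter Topology Set
open scoped NNReal ENNReal
open Literature.NumberTheory.GaloisRepresentations Literature.NumberTheory.GaloisRepresentations.IsNonarchimedeanLocalField
open Literature.NumberTheory.Automorphic Literature.NumberTheory.Automorphic.LocalFieldHaar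
open Summit.HodgeConjecture.HodgeConjecture.Cruxes.HLiu418.K2LiuGKRankOneIntegral (one_lt_residueFieldCard_real)
open Summit.HodgeConjecture.HodgeConjecture.Cruxes.H413.K2E1GindikinKarpelevichSplitGL3Cpow (integral_prod_bigCell_gl3_cpow_eq)
open Summit.HodgeConjecture.HodgeConjecture.Cruxes.H413.K2E1BigCellCoordinateChangeGL3 (integral_comp_bigCellChange_eq)

namespace Summit.HodgeConjecture.HodgeConjecture.Cruxes.H413.K2E1ChiIntertwiningLocalScalarSplitU3

variable {F : Type*} [Field F] [ValuativeRel F] [TopologicalSpace F] [IsNonarchimedeanLocalField F]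
variable [MeasurableSpace F] [BorelSpace F] (μ : Measure F) [μ.IsAddHaarMeasure]

/-! ## §1 Transport of ★ `integral_prod_bigCell_gl3_cpow_eq` to `Fin 3 → F` and to the base coordinates `Φ` -/

/-- **ON `Fin 3 → F`** (order `(x, y, z) = (q₀, q₁, q₂)`, the currency of ★ `K2E1IntertwiningLocalMeanSplitU3`; the coordinate equivalence `E q = (q₀, (q₂, q₁))` carries `μ³` to `μ ⊗ (μ ⊗ μ)`).
[cite: TateThesis1967, §3.3] [cite: Langlands1971, §3] -/
theorem integral_gkCell_pi_cpow_eq {w₁ w₂ : ℂ} (hw₁ : 1 < w₁.re) (hw₂ : 1 < w₂.re) :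
    ∫ q : Fin 3 → F, ((max 1 (max ((normAbs F (q 0) : ℝ≥0) : ℝ) ((normAbs F (q 2) : ℝ≥0) : ℝ)) : ℝ) : ℂ) ^ (-w₁) *
        ((max 1 (max ((normAbs F (q 1) : ℝ≥0) : ℝ) ((normAbs F (q 2 - q 0 * q 1) : ℝ≥0) : ℝ)) : ℝ) : ℂ) ^ (-w₂) ∂(Measure.pi fun _ : Fin 3 => μ) =
      ((μ.real (primePowBall F 0) : ℝ) : ℂ) ^ 3 *
        (((1 - (residueFieldCard F : ℂ) ^ (-w₁)) / (1 - (residueFieldCard F : ℂ) ^ (1 - w₁))) *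
          ((1 - (residueFieldCard F : ℂ) ^ (-w₂)) / (1 - (residueFieldCard F : ℂ) ^ (1 - w₂))) *
          ((1 - (residueFieldCard F : ℂ) ^ (-(w₁ + w₂ - 1))) / (1 - (residueFieldCard F : ℂ) ^ (-(w₁ + w₂ - 2))))) := by
  haveI := secondCountableTopology_localField F
  haveI := sigmaCompactSpace_of_isNonarchimedeanLocalField F
  set e₁ : (Fin 3 → F) ≃ᵐ F × (Fin 2 → F) := MeasurableEquiv.piFinSuccAbove (fun _ : Fin 3 => F) 0 with he₁
  have h₁ : MeasurePreserving e₁ (Measure.pi fun _ : Fin 3 => μ) (μ.prod (Measure.pi fun _ : Fin 2 => μ)) := measurePreserving_piFinSuccAbove (fun _ : Fin 3 => μ) 0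
  have h₂ : MeasurePreserving (MeasurableEquiv.finTwoArrow (α := F)) (Measure.pi fun _ : Fin 2 => μ) (μ.prod μ) := measurePreserving_finTwoArrow μ
  have h₃ : MeasurePreserving (MeasurableEquiv.prodComm (α := F) (β := F)) (μ.prod μ) (μ.prod μ) := measurePreserving_swap
  set E : (Fin 3 → F) ≃ᵐ F × (F × F) := e₁.trans (MeasurableEquiv.prodCongr (MeasurableEquiv.refl F) ((MeasurableEquiv.finTwoArrow (α := F)).trans (MeasurableEquiv.prodComm (α := F) (β := F)))) with hE
  have hEmp : MeasurePreserving E (Measure.pi fun _ : Fin 3 => μ) (μ.prod (μ.prod μ)) :=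
    ((MeasurePreserving.id μ).prod (h₃.comp h₂)).comp h₁
  rw [← integral_prod_bigCell_gl3_cpow_eq μ hw₁ hw₂, ← hEmp.integral_comp']
  rfl
/-- **IN THE BASE COORDINATES `Φ(a,b,t) = (a + δ₁b, −(a − δ₁b), δ₁t − ½(a+δ₁b)(a−δ₁b))`** (`‖δ₁‖ = ‖2‖ = 1`; ★ `integral_comp_bigCellChange_eq`): the two-exponent split cell in the letters of
★ `integral_splitCell_pi_eq` with `(·:ℂ)^(−w₁)`, `(·:ℂ)^(−w₂)`. [cite: Langlands1971, §3] [cite: MoeglinWaldspurger1995, II.1.7] -/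
theorem integral_splitCell_pi_cpow_eq {δ₁ : F} (hδ : normAbs F δ₁ = 1) (h2 : normAbs F 2 = 1) {w₁ w₂ : ℂ} (hw₁ : 1 < w₁.re) (hw₂ : 1 < w₂.re) :
    ∫ p : Fin 3 → F, (fun q : Fin 3 → F => ((max 1 (max ((normAbs F (q 0) : ℝ≥0) : ℝ) ((normAbs F (q 2) : ℝ≥0) : ℝ)) : ℝ) : ℂ) ^ (-w₁) *
        ((max 1 (max ((normAbs F (q 1) : ℝ≥0) : ℝ) ((normAbs F (q 2 - q 0 * q 1) : ℝ≥0) : ℝ)) : ℝ) : ℂ) ^ (-w₂))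
        ![p 0 + δ₁ * p 1, -(p 0 - δ₁ * p 1), δ₁ * p 2 - 2⁻¹ * (p 0 + δ₁ * p 1) * (p 0 - δ₁ * p 1)] ∂(Measure.pi fun _ : Fin 3 => μ) =
      ((μ.real (primePowBall F 0) : ℝ) : ℂ) ^ 3 *
        (((1 - (residueFieldCard F : ℂ) ^ (-w₁)) / (1 - (residueFieldCard F : ℂ) ^ (1 - w₁))) *
          ((1 - (residueFieldCard F : ℂ) ^ (-w₂)) / (1 - (residueFieldCard F : ℂ) ^ (1 - w₂))) *
          ((1 - (residueFieldCard F : ℂ) ^ (-(w₁ + w₂ - 1))) / (1 - (residueFieldCard F : ℂ) ^ (-(w₁ + w₂ - 2))))) := by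
  have h := integral_comp_bigCellChange_eq μ hδ h2 (fun q : Fin 3 → F => ((max 1 (max ((normAbs F (q 0) : ℝ≥0) : ℝ) ((normAbs F (q 2) : ℝ≥0) : ℝ)) : ℝ) : ℂ) ^ (-w₁) *
    ((max 1 (max ((normAbs F (q 1) : ℝ≥0) : ℝ) ((normAbs F (q 2 - q 0 * q 1) : ℝ≥0) : ℝ)) : ℝ) : ℂ) ^ (-w₂))
  rw [h, integral_gkCell_pi_cpow_eq μ hw₁ hw₂]

/-! ## §2 Unit twists are imaginary shifts of the exponent -/

omit [MeasurableSpace F] [BorelSpace F] in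
/-- **`‖u‖ = 1 ⇒ q^{−it} = u` for `t := −arg u ∕ log q`** (`q = q_F > 1`). [folklore] -/
theorem exists_cpow_neg_mul_I_eq_of_norm_eq_one {u : ℂ} (hu : ‖u‖ = 1) :
    ∃ t : ℝ, (residueFieldCard F : ℂ) ^ (-((t : ℂ) * Complex.I)) = u := by
  have hq1 : (1 : ℝ) < residueFieldCard F := one_lt_residueFieldCard_real
  have hq0 : (0 : ℝ) < residueFieldCard F := one_pos.trans hq1
  have hlog : Real.log (residueFieldCard F : ℝ) ≠ 0 := (Real.log_pos hq1).ne'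
  refine ⟨-Complex.arg u / Real.log (residueFieldCard F : ℝ), ?_⟩
  have hq0' : ((residueFieldCard F : ℝ) : ℂ) ≠ 0 := by exact_mod_cast hq0.ne'
  have hL : ((Real.log (residueFieldCard F : ℝ) : ℝ) : ℂ) ≠ 0 := by exact_mod_cast hlog
  have key : ((Real.log (residueFieldCard F : ℝ) : ℝ) : ℂ) * -(((-Complex.arg u / Real.log (residueFieldCard F : ℝ) : ℝ) : ℂ) * Complex.I) =
      (Complex.arg u : ℂ) * Complex.I := by
    rw [Complex.ofReal_div, Complex.ofReal_neg]
    field_simp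
  rw [show (residueFieldCard F : ℂ) = ((residueFieldCard F : ℝ) : ℂ) by push_cast; rfl, Complex.cpow_def_of_ne_zero hq0',
    ← Complex.ofReal_log hq0.le, key]
  calc Complex.exp ((Complex.arg u : ℂ) * Complex.I) = (‖u‖ : ℂ) * Complex.exp ((Complex.arg u : ℂ) * Complex.I) := by rw [hu, Complex.ofReal_one, one_mul]
    _ = u := Complex.norm_mul_exp_arg_mul_I u

omit [MeasurableSpace F] [BorelSpace F] in
/-- **A unit power is an imaginary shift**: if `q^{−it} = u` then `u^a · (q^a)^{−z} = (q^a)^{−(z + it)}` (`a : ℕ`; positive real base, ★ `ofReal_pow_cpow`). [folklore] -/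
theorem pow_mul_ofReal_pow_cpow_neg {u : ℂ} {t : ℝ} (hut : (residueFieldCard F : ℂ) ^ (-((t : ℂ) * Complex.I)) = u) (a : ℕ) (z : ℂ) :
    u ^ a * (((residueFieldCard F : ℝ) ^ a : ℝ) : ℂ) ^ (-z) = (((residueFieldCard F : ℝ) ^ a : ℝ) : ℂ) ^ (-(z + (t : ℂ) * Complex.I)) := by
  have hq0' : (residueFieldCard F : ℂ) ≠ 0 := by exact_mod_cast (one_pos.trans one_lt_residueFieldCard_real).ne'
  rw [Summit.HodgeConjecture.HodgeConjecture.Cruxes.HLiu418.K2LiuGKRankOneIntegral.ofReal_pow_cpow,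
    Summit.HodgeConjecture.HodgeConjecture.Cruxes.HLiu418.K2LiuGKRankOneIntegral.ofReal_pow_cpow, ← hut, ← mul_pow, ← Complex.cpow_add _ _ hq0']
  congr 2
  ring

omit [MeasurableSpace F] [BorelSpace F] in
/-- `q^{−(s + it)} = u · q^{−s}` and `q^{c − (s + it)} = u · q^{c − s}` when `q^{−it} = u` — the token rewrite. [folklore] -/
theorem cpow_neg_add_mul_I {u : ℂ} {t : ℝ} (hut : (residueFieldCard F : ℂ) ^ (-((t : ℂ) * Complex.I)) = u) (s c : ℂ) :
    (residueFieldCard F : ℂ) ^ (-(s + (t : ℂ) * Complex.I)) = u * (residueFieldCard F : ℂ) ^ (-s) ∧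
      (residueFieldCard F : ℂ) ^ (c - (s + (t : ℂ) * Complex.I)) = u * (residueFieldCard F : ℂ) ^ (c - s) := by
  have hq0' : (residueFieldCard F : ℂ) ≠ 0 := by exact_mod_cast (one_pos.trans one_lt_residueFieldCard_real).ne'
  refine ⟨?_, ?_⟩
  · rw [neg_add, Complex.cpow_add _ _ hq0', hut, mul_comm]
  · rw [show c - (s + (t : ℂ) * Complex.I) = (c - s) + -((t : ℂ) * Complex.I) by ring, Complex.cpow_add _ _ hq0', hut, mul_comm]

/-! ## §3 HEAD — the χ-weighted split local integral under the split SHELL LETTER (+ the CM corollary `u₁u₂ = 1`) -/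

/-- **THE χ-TWISTED `U(2,1)` INTERTWINING LOCAL INTEGRAL AT A SPLIT GOOD PLACE** (hypothesis-first on the split SHELL LETTER).  `F` a non-archimedean local field, `μ` any additive Haar
measure, `‖δ₁‖ = ‖2‖ = 1`; two unit complex numbers `u₁, u₂` (the unramified torus character's values on the two heights); a weight `ω : (Fin 3 → F) → ℂ` with the SHELL LETTER
`hshell : ∀ p, ∃ a b : ℕ, A(Φ p) = q^a ∧ B(Φ p) = q^b ∧ ω p = u₁^a·u₂^b` (`A = max(1,|x|,|z|)`, `B = max(1,|y|,|z−xy|)` at `(x,y,z) = Φ(p)`); `1 < Re z`.  THEN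
`∫ ω(p)·A(Φp)^{−z}·B(Φp)^{−z} dμ³(p) = μ(𝒪)³ · (1 − u₁q^{−z})(1 − u₂q^{−z})(1 − u₁u₂q^{−(2z−1)}) ∕ ((1 − u₁q^{−(z−1)})(1 − u₂q^{−(z−1)})(1 − u₁u₂q^{−(2z−2)}))` — §2 at
`(w₁, w₂) = (z + it₁, z + it₂)`, `q^{−it_i} = u_i` (§3).  At `u₁ = u₂ = 1`: the ★ split token (`ε_v = +1`).  Division by `μ³(𝒪³) = μ(𝒪)³` and the bridge `Q_v = A(Φ·)B(Φ·)` to the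
adelic currency are the consumer's ★ rewrites (`pi_integralBox_toReal`, `localHeight_rpow_eq_gl3_of_split`). [cite: Casselman1980, Thm. 3.1] [cite: Langlands1971, §3]
[cite: MoeglinWaldspurger1995, IV.1.11] [cite: Rogawski1990, §4.5 p. 45] -/
theorem chiLocalIntegral_eq_token_of_shell_split {δ₁ : F} (hδ : normAbs F δ₁ = 1) (h2 : normAbs F 2 = 1) {u₁ u₂ : ℂ} (hu₁ : ‖u₁‖ = 1) (hu₂ : ‖u₂‖ = 1)
    (ω : (Fin 3 → F) → ℂ)
    (hshell : ∀ p : Fin 3 → F, ∃ a b : ℕ,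
      max 1 (max ((normAbs F (p 0 + δ₁ * p 1) : ℝ≥0) : ℝ) ((normAbs F (δ₁ * p 2 - 2⁻¹ * (p 0 + δ₁ * p 1) * (p 0 - δ₁ * p 1)) : ℝ≥0) : ℝ)) = (residueFieldCard F : ℝ) ^ a ∧
      max 1 (max ((normAbs F (-(p 0 - δ₁ * p 1)) : ℝ≥0) : ℝ)
          ((normAbs F (δ₁ * p 2 - 2⁻¹ * (p 0 + δ₁ * p 1) * (p 0 - δ₁ * p 1) - (p 0 + δ₁ * p 1) * (-(p 0 - δ₁ * p 1))) : ℝ≥0) : ℝ)) = (residueFieldCard F : ℝ) ^ b ∧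
      ω p = u₁ ^ a * u₂ ^ b)
    {z : ℂ} (hz : 1 < z.re) :
    ∫ p : Fin 3 → F, ω p *
        (((max 1 (max ((normAbs F (p 0 + δ₁ * p 1) : ℝ≥0) : ℝ) ((normAbs F (δ₁ * p 2 - 2⁻¹ * (p 0 + δ₁ * p 1) * (p 0 - δ₁ * p 1)) : ℝ≥0) : ℝ)) : ℝ) : ℂ) ^ (-z) *
          ((max 1 (max ((normAbs F (-(p 0 - δ₁ * p 1)) : ℝ≥0) : ℝ)
            ((normAbs F (δ₁ * p 2 - 2⁻¹ * (p 0 + δ₁ * p 1) * (p 0 - δ₁ * p 1) - (p 0 + δ₁ * p 1) * (-(p 0 - δ₁ * p 1))) : ℝ≥0) : ℝ)) : ℝ) : ℂ) ^ (-z)) ∂(Measure.pi fun _ : Fin 3 => μ) =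
      ((μ.real (primePowBall F 0) : ℝ) : ℂ) ^ 3 *
        (((1 - u₁ * (residueFieldCard F : ℂ) ^ (-z)) * (1 - u₂ * (residueFieldCard F : ℂ) ^ (-z)) * (1 - u₁ * u₂ * (residueFieldCard F : ℂ) ^ (-(2 * z - 1)))) /
          ((1 - u₁ * (residueFieldCard F : ℂ) ^ (-(z - 1))) * (1 - u₂ * (residueFieldCard F : ℂ) ^ (-(z - 1))) * (1 - u₁ * u₂ * (residueFieldCard F : ℂ) ^ (-(2 * z - 2))))) := by
  obtain ⟨t₁, ht₁⟩ := exists_cpow_neg_mul_I_eq_of_norm_eq_one (F := F) hu₁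
  obtain ⟨t₂, ht₂⟩ := exists_cpow_neg_mul_I_eq_of_norm_eq_one (F := F) hu₂
  have hw₁ : 1 < (z + (t₁ : ℂ) * Complex.I).re := by simpa using hz
  have hw₂ : 1 < (z + (t₂ : ℂ) * Complex.I).re := by simpa using hz
  -- pointwise: the weight is absorbed into the two exponents
  have hpt : ∀ p : Fin 3 → F, ω p *
        (((max 1 (max ((normAbs F (p 0 + δ₁ * p 1) : ℝ≥0) : ℝ) ((normAbs F (δ₁ * p 2 - 2⁻¹ * (p 0 + δ₁ * p 1) * (p 0 - δ₁ * p 1)) : ℝ≥0) : ℝ)) : ℝ) : ℂ) ^ (-z) *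
          ((max 1 (max ((normAbs F (-(p 0 - δ₁ * p 1)) : ℝ≥0) : ℝ)
            ((normAbs F (δ₁ * p 2 - 2⁻¹ * (p 0 + δ₁ * p 1) * (p 0 - δ₁ * p 1) - (p 0 + δ₁ * p 1) * (-(p 0 - δ₁ * p 1))) : ℝ≥0) : ℝ)) : ℝ) : ℂ) ^ (-z)) =
      (fun q : Fin 3 → F => ((max 1 (max ((normAbs F (q 0) : ℝ≥0) : ℝ) ((normAbs F (q 2) : ℝ≥0) : ℝ)) : ℝ) : ℂ) ^ (-(z + (t₁ : ℂ) * Complex.I)) *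
        ((max 1 (max ((normAbs F (q 1) : ℝ≥0) : ℝ) ((normAbs F (q 2 - q 0 * q 1) : ℝ≥0) : ℝ)) : ℝ) : ℂ) ^ (-(z + (t₂ : ℂ) * Complex.I)))
        ![p 0 + δ₁ * p 1, -(p 0 - δ₁ * p 1), δ₁ * p 2 - 2⁻¹ * (p 0 + δ₁ * p 1) * (p 0 - δ₁ * p 1)] := by
    intro p
    obtain ⟨a, b, hA, hB, hω⟩ := hshell p
    simp only [Matrix.cons_val_zero, Matrix.cons_val_one, Matrix.cons_val_two, Matrix.head_cons, Matrix.tail_cons]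
    rw [hA, hB, hω, ← pow_mul_ofReal_pow_cpow_neg ht₁ a z, ← pow_mul_ofReal_pow_cpow_neg ht₂ b z]
    ring
  simp_rw [hpt]
  rw [integral_splitCell_pi_cpow_eq μ hδ h2 hw₁ hw₂, div_mul_div_comm, div_mul_div_comm]
  -- every power as a monomial in `X := q^{−z}` and `q`, with `q^{−it_i} = u_i`
  have hq0' : (residueFieldCard F : ℂ) ≠ 0 := by exact_mod_cast (one_pos.trans one_lt_residueFieldCard_real).ne'
  have e1 : (residueFieldCard F : ℂ) ^ (-(z + (t₁ : ℂ) * Complex.I)) = u₁ * (residueFieldCard F : ℂ) ^ (-z) := (cpow_neg_add_mul_I ht₁ z 1).1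
  have e3 : (residueFieldCard F : ℂ) ^ (-(z + (t₂ : ℂ) * Complex.I)) = u₂ * (residueFieldCard F : ℂ) ^ (-z) := (cpow_neg_add_mul_I ht₂ z 1).1
  have e2 : (residueFieldCard F : ℂ) ^ (1 - (z + (t₁ : ℂ) * Complex.I)) = u₁ * ((residueFieldCard F : ℂ) * (residueFieldCard F : ℂ) ^ (-z)) := by
    rw [show (1 : ℂ) - (z + (t₁ : ℂ) * Complex.I) = 1 + -z + -((t₁ : ℂ) * Complex.I) by ring, Complex.cpow_add _ _ hq0', Complex.cpow_add _ _ hq0', Complex.cpow_one, ht₁]; ring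
  have e4 : (residueFieldCard F : ℂ) ^ (1 - (z + (t₂ : ℂ) * Complex.I)) = u₂ * ((residueFieldCard F : ℂ) * (residueFieldCard F : ℂ) ^ (-z)) := by
    rw [show (1 : ℂ) - (z + (t₂ : ℂ) * Complex.I) = 1 + -z + -((t₂ : ℂ) * Complex.I) by ring, Complex.cpow_add _ _ hq0', Complex.cpow_add _ _ hq0', Complex.cpow_one, ht₂]; ring
  have e5 : (residueFieldCard F : ℂ) ^ (-(z + (t₁ : ℂ) * Complex.I + (z + (t₂ : ℂ) * Complex.I) - 1)) =
      u₁ * u₂ * ((residueFieldCard F : ℂ) * (residueFieldCard F : ℂ) ^ (-z) * (residueFieldCard F : ℂ) ^ (-z)) := by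
    rw [show -(z + (t₁ : ℂ) * Complex.I + (z + (t₂ : ℂ) * Complex.I) - 1) = 1 + -z + -z + -((t₁ : ℂ) * Complex.I) + -((t₂ : ℂ) * Complex.I) by ring,
      Complex.cpow_add _ _ hq0', Complex.cpow_add _ _ hq0', Complex.cpow_add _ _ hq0', Complex.cpow_add _ _ hq0', Complex.cpow_one, ht₁, ht₂]; ring
  have e6 : (residueFieldCard F : ℂ) ^ (-(z + (t₁ : ℂ) * Complex.I + (z + (t₂ : ℂ) * Complex.I) - 2)) =
      u₁ * u₂ * ((residueFieldCard F : ℂ) * (residueFieldCard F : ℂ) * (residueFieldCard F : ℂ) ^ (-z) * (residueFieldCard F : ℂ) ^ (-z)) := by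
    rw [show -(z + (t₁ : ℂ) * Complex.I + (z + (t₂ : ℂ) * Complex.I) - 2) = 1 + 1 + -z + -z + -((t₁ : ℂ) * Complex.I) + -((t₂ : ℂ) * Complex.I) by ring,
      Complex.cpow_add _ _ hq0', Complex.cpow_add _ _ hq0', Complex.cpow_add _ _ hq0', Complex.cpow_add _ _ hq0', Complex.cpow_add _ _ hq0', Complex.cpow_one, ht₁, ht₂]; ring
  have f1 : (residueFieldCard F : ℂ) ^ (-(z - 1)) = (residueFieldCard F : ℂ) * (residueFieldCard F : ℂ) ^ (-z) := by
    rw [show -(z - 1) = (1 : ℂ) + -z by ring, Complex.cpow_add _ _ hq0', Complex.cpow_one]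
  have f2 : (residueFieldCard F : ℂ) ^ (-(2 * z - 1)) = (residueFieldCard F : ℂ) * (residueFieldCard F : ℂ) ^ (-z) * (residueFieldCard F : ℂ) ^ (-z) := by
    rw [show -(2 * z - 1) = (1 : ℂ) + -z + -z by ring, Complex.cpow_add _ _ hq0', Complex.cpow_add _ _ hq0', Complex.cpow_one]
  have f3 : (residueFieldCard F : ℂ) ^ (-(2 * z - 2)) = (residueFieldCard F : ℂ) * (residueFieldCard F : ℂ) * (residueFieldCard F : ℂ) ^ (-z) * (residueFieldCard F : ℂ) ^ (-z) := by
    rw [show -(2 * z - 2) = (1 : ℂ) + 1 + -z + -z by ring, Complex.cpow_add _ _ hq0', Complex.cpow_add _ _ hq0', Complex.cpow_add _ _ hq0', Complex.cpow_one]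
  rw [e1, e2, e3, e4, e5, e6, f1, f2, f3]

/-- **CM COROLLARY (`u₁u₂ = 1`)** — the S8 Borel datum has `φ′ = ω`, so at a split good place `φ_w(ϖ)·φ_{w̄}(ϖ) = ω_v(ϖ_v) = 1` and the long-root unit is `1`: the χ-weighted split local
integral is `μ(𝒪)³ · (1 − u₁q^{−z})(1 − u₂q^{−z})(1 − q^{−(2z−1)}) ∕ ((1 − u₁q^{−(z−1)})(1 − u₂q^{−(z−1)})(1 − q^{−(2z−2)}))` (the GL₃ three-root token of R90-C10-p07's census; S8-R56 (ii)).
[cite: Casselman1980, Thm. 3.1] [cite: Rogawski1990, §4.5 p. 45] -/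
theorem chiLocalIntegral_eq_token_of_shell_split_cm {δ₁ : F} (hδ : normAbs F δ₁ = 1) (h2 : normAbs F 2 = 1) {u₁ u₂ : ℂ} (hu₁ : ‖u₁‖ = 1) (hu₂ : ‖u₂‖ = 1) (hu : u₁ * u₂ = 1)
    (ω : (Fin 3 → F) → ℂ)
    (hshell : ∀ p : Fin 3 → F, ∃ a b : ℕ,
      max 1 (max ((normAbs F (p 0 + δ₁ * p 1) : ℝ≥0) : ℝ) ((normAbs F (δ₁ * p 2 - 2⁻¹ * (p 0 + δ₁ * p 1) * (p 0 - δ₁ * p 1)) : ℝ≥0) : ℝ)) = (residueFieldCard F : ℝ) ^ a ∧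
      max 1 (max ((normAbs F (-(p 0 - δ₁ * p 1)) : ℝ≥0) : ℝ)
          ((normAbs F (δ₁ * p 2 - 2⁻¹ * (p 0 + δ₁ * p 1) * (p 0 - δ₁ * p 1) - (p 0 + δ₁ * p 1) * (-(p 0 - δ₁ * p 1))) : ℝ≥0) : ℝ)) = (residueFieldCard F : ℝ) ^ b ∧
      ω p = u₁ ^ a * u₂ ^ b)
    {z : ℂ} (hz : 1 < z.re) :
    ∫ p : Fin 3 → F, ω p *
        (((max 1 (max ((normAbs F (p 0 + δ₁ * p 1) : ℝ≥0) : ℝ) ((normAbs F (δ₁ * p 2 - 2⁻¹ * (p 0 + δ₁ * p 1) * (p 0 - δ₁ * p 1)) : ℝ≥0) : ℝ)) : ℝ) : ℂ) ^ (-z) *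
          ((max 1 (max ((normAbs F (-(p 0 - δ₁ * p 1)) : ℝ≥0) : ℝ)
            ((normAbs F (δ₁ * p 2 - 2⁻¹ * (p 0 + δ₁ * p 1) * (p 0 - δ₁ * p 1) - (p 0 + δ₁ * p 1) * (-(p 0 - δ₁ * p 1))) : ℝ≥0) : ℝ)) : ℝ) : ℂ) ^ (-z)) ∂(Measure.pi fun _ : Fin 3 => μ) =
      ((μ.real (primePowBall F 0) : ℝ) : ℂ) ^ 3 *
        (((1 - u₁ * (residueFieldCard F : ℂ) ^ (-z)) * (1 - u₂ * (residueFieldCard F : ℂ) ^ (-z)) * (1 - (residueFieldCard F : ℂ) ^ (-(2 * z - 1)))) /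
          ((1 - u₁ * (residueFieldCard F : ℂ) ^ (-(z - 1))) * (1 - u₂ * (residueFieldCard F : ℂ) ^ (-(z - 1))) * (1 - (residueFieldCard F : ℂ) ^ (-(2 * z - 2))))) := by
  rw [chiLocalIntegral_eq_token_of_shell_split μ hδ h2 hu₁ hu₂ ω hshell hz, hu, one_mul, one_mul]

end Summit.HodgeConjecture.HodgeConjecture.Cruxes.H413.K2E1ChiIntertwiningLocalScalarSplitU3

end
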